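/-
Copyright (c) 2026. All rights reserved.
Released under Apache 2.0 license as described in the file LICENSE.
Authors: HodgeCM publication cell (pub-hodgecm), DAG-node prover lineage #13 (gen 4: statements and proofs;
gen 7: tree port).
-/
import Literature.RepresentationTheory.HeisenbergGroup.StoneVonNeumannProjections

/-!
# Stone–von Neumann on `L²(X)`, II: cosets of a chain of compact open subgroups; π-λ; density

Topic `RepresentationTheory/HeisenbergGroup`; namespace
`Literature.RepresentationTheory.HeisenbergGroup.SchrodingerIrreducible` (continued from
`StoneVonNeumannProjections.lean`).  For a locally compact second countable abelian group `X` with Haar measure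
`μ` and a decreasing sequence `B 0 ≥ B 1 ≥ …` of compact open subgroups forming a neighbourhood basis of `0`,
the cosets `a + B k` form a topological basis and a π-system generating the Borel σ-algebra; hence
(**`eq_zero_of_vanish_on_cosets`**) a bounded operator on `L²(X, μ)` that kills the indicator class of every
coset of every `B k` is ZERO — Dynkin's π-λ theorem on each coset of `B 0`, a countable cover of `X` by such
cosets, `L²`-continuity along increasing unions, and density of simple functions.

Source.  This is the `L²` form of the generation statement closing the irreducibility argument of C. Mœglin,
M.-F. Vignéras, J.-L. Waldspurger, *Correspondances de Howe sur un corps p-adique*, LNM 1291 (1987)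
[MoeglinVignerasWaldspurger1987], Chap. 2 I.3 (held text `book:moeglinnd-correspondances-de-howe-sur-un-corps-p`,
chunk p0031 L17): having shown that an invariant subspace contains the functions `f_{w,L}` attached to the
cosets `A + w + L` of compact open subgroups `L`, "Ces fonctions engendrant `S_A`, on a `S' = S_A`".  On the
unitary completion (A. Weil, Acta Math. 111 (1964) [Weil1964], Chap. I) "engendrant" becomes: the indicator
classes of the cosets are TOTAL in `L²(X)`, which is what is proved here, phrased for operators.

WHAT IS REPRODUCED (kernel proofs from Mathlib only):
* §1 `coset B a = {u : u - a ∈ B}`: measurability, measure `= μ B`, openness, and the nesting property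
  `coset_subset_of_le` (cosets of a chain are disjoint or comparable);
* §2 partial unions `punion f n = f 0 ∪ … ∪ f n` of a sequence of sets (bookkeeping for the λ-system step);
* §3 `map_indicatorConstLp_iUnion_eq_zero`: an operator killing the indicators of a disjoint sequence with
  union of finite measure kills the indicator of the union;
* §4 the density theorem `eq_zero_of_vanish_on_cosets`.

Provenance: tree port (LEAN-IN-TREE, 2026-08-18) of §4 of the HodgeCM publication cell's package file
`HodgeCM/PerL34/LocalFactors/SchrodingerIrreducible.lean` (unit `pub-hodgecm-pv13-g4`, gate run 28; statements
and proofs verbatim, namespace `HodgeCM.PerL34.LocalFactors.SchrodingerIrreducible` ↦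
`Literature.RepresentationTheory.HeisenbergGroup.SchrodingerIrreducible`).
-/

set_option autoImplicit false

noncomputable section

open MeasureTheory MeasureTheory.Measure Set Complex Filter Topology Function
open scoped ENNReal NNReal Pointwise InnerProductSpace symmDiff

namespace Literature.RepresentationTheory.HeisenbergGroup.SchrodingerIrreducible

open SchrodingerLevi

/-! ## §1 Cosets of a chain of compact open subgroups -/

section Density

variable {X : Type*} [AddCommGroup X] [TopologicalSpace X] [IsTopologicalAddGroup X]
  [MeasurableSpace X] [BorelSpace X] (μ : Measure X) [μ.IsAddHaarMeasure]

/-- the coset `a + B`, written as the preimage `{u : u + (-a) ∈ B}` (the shape `τ_{-a}` produces) [folklore] -/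
def coset (B : AddSubgroup X) (a : X) : Set X := (fun u => u + -a) ⁻¹' (B : Set X)

omit [TopologicalSpace X] [IsTopologicalAddGroup X] [MeasurableSpace X] [BorelSpace X] in
/-- `u ∈ coset B a ↔ u - a ∈ B`. [folklore] -/
theorem mem_coset {B : AddSubgroup X} {a u : X} : u ∈ coset B a ↔ u - a ∈ B := by
  simp [coset, sub_eq_add_neg]

omit [TopologicalSpace X] [IsTopologicalAddGroup X] [MeasurableSpace X] [BorelSpace X] in
/-- `a ∈ coset B a`. [folklore] -/
theorem self_mem_coset (B : AddSubgroup X) (a : X) : a ∈ coset B a := by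
  rw [mem_coset, sub_self]; exact B.zero_mem

/-- cosets of a measurable subgroup are measurable. [folklore] -/
theorem measurableSet_coset {B : AddSubgroup X} (hB : MeasurableSet (B : Set X)) (a : X) :
    MeasurableSet (coset B a) :=
  hB.preimage (measurable_add_const (-a))

/-- cosets have the Haar measure of the subgroup. [folklore] -/
theorem measure_coset {B : AddSubgroup X} (hB : MeasurableSet (B : Set X)) (a : X) : μ (coset B a) = μ B :=
  (measurePreserving_add_right μ (-a)).measure_preimage hB.nullMeasurableSet

omit [MeasurableSpace X] [BorelSpace X] in
/-- cosets of an open subgroup are open. [folklore] -/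
theorem isOpen_coset {B : AddSubgroup X} (hB : IsOpen (B : Set X)) (a : X) : IsOpen (coset B a) :=
  hB.preimage (continuous_id.add continuous_const)

omit [TopologicalSpace X] [IsTopologicalAddGroup X] [MeasurableSpace X] [BorelSpace X] in
/-- nested cosets are disjoint or comparable [folklore] -/
theorem coset_subset_of_le {B B' : AddSubgroup X} (h : B' ≤ B) {a a' x : X} (hx : x ∈ coset B a)
    (hx' : x ∈ coset B' a') : coset B' a' ⊆ coset B a := by
  intro u hu
  rw [mem_coset] at *
  have : u - a = (u - a') - (x - a') + (x - a) := by abel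
  rw [this]
  exact B.add_mem (B.sub_mem (h hu) (h hx')) hx

/-! ## §2 Partial unions of a sequence of sets -/

/-- partial unions of a sequence of sets [folklore] -/
def punion (f : ℕ → Set X) : ℕ → Set X
  | 0 => f 0
  | n + 1 => punion f n ∪ f (n + 1)

omit [AddCommGroup X] [TopologicalSpace X] [IsTopologicalAddGroup X] [MeasurableSpace X] [BorelSpace X] in
/-- `punion f n ⊆ ⋃ i, f i`. [folklore] -/
theorem punion_subset (f : ℕ → Set X) (n : ℕ) : punion f n ⊆ ⋃ i, f i := by
  induction n with
  | zero => exact subset_iUnion f 0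
  | succ n ih => exact union_subset ih (subset_iUnion f (n + 1))

omit [AddCommGroup X] [TopologicalSpace X] [IsTopologicalAddGroup X] [MeasurableSpace X] [BorelSpace X] in
/-- `f i ⊆ punion f n` for `i ≤ n`. [folklore] -/
theorem subset_punion (f : ℕ → Set X) : ∀ {i n : ℕ}, i ≤ n → f i ⊆ punion f n
  | i, 0, h => by rw [Nat.le_zero.1 h]; exact subset_rfl
  | i, n + 1, h => by
      rcases Nat.of_le_succ h with h' | h'
      · exact (subset_punion f h').trans subset_union_left
      · rw [h']; exact subset_union_right

omit [AddCommGroup X] [TopologicalSpace X] [IsTopologicalAddGroup X] [MeasurableSpace X] [BorelSpace X] in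
/-- the partial unions exhaust `⋃ n, f n`. [folklore] -/
theorem iUnion_punion (f : ℕ → Set X) : ⋃ n, punion f n = ⋃ n, f n :=
  subset_antisymm (iUnion_subset fun n => punion_subset f n)
    (iUnion_subset fun n => (subset_punion f le_rfl).trans (subset_iUnion _ n))

omit [AddCommGroup X] [TopologicalSpace X] [IsTopologicalAddGroup X] [MeasurableSpace X] [BorelSpace X] in
/-- the partial unions increase. [folklore] -/
theorem monotone_punion (f : ℕ → Set X) : Monotone (punion f) :=
  monotone_nat_of_le_succ fun _ => subset_union_left

omit [AddCommGroup X] [TopologicalSpace X] [IsTopologicalAddGroup X] [BorelSpace X] in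
/-- partial unions of measurable sets are measurable. [folklore] -/
theorem measurableSet_punion {f : ℕ → Set X} (hf : ∀ i, MeasurableSet (f i)) :
    ∀ n, MeasurableSet (punion f n)
  | 0 => hf 0
  | n + 1 => (measurableSet_punion hf n).union (hf _)

omit [AddCommGroup X] [TopologicalSpace X] [IsTopologicalAddGroup X] [MeasurableSpace X] [BorelSpace X] in
/-- `punion f n` is disjoint from `f m` for `m > n` when the `f i` are pairwise disjoint. [folklore] -/
theorem disjoint_punion {f : ℕ → Set X} (hd : Pairwise (Disjoint on f)) :
    ∀ n m : ℕ, n < m → Disjoint (punion f n) (f m)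
  | 0, _, h => hd (Nat.ne_of_lt h)
  | n + 1, m, h => disjoint_union_left.2 ⟨disjoint_punion hd n m (Nat.lt_of_succ_lt h), hd (Nat.ne_of_lt h)⟩

/-! ## §3 `L²`-continuity along disjoint unions -/

omit [AddCommGroup X] [TopologicalSpace X] [IsTopologicalAddGroup X] [BorelSpace X] [μ.IsAddHaarMeasure] in
/-- (L) a bounded operator killing the indicators of the members of a disjoint sequence of sets with union
of finite measure kills the indicator of the union (`L²`-continuity) [folklore] -/
theorem map_indicatorConstLp_iUnion_eq_zero (T : Lp ℂ 2 μ →L[ℂ] Lp ℂ 2 μ) (f : ℕ → Set X)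
    (hfm : ∀ i, MeasurableSet (f i)) (hdisj : Pairwise (Disjoint on f)) (hfin : μ (⋃ i, f i) ≠ ∞)
    (h0 : ∀ i (hi : μ (f i) ≠ ∞), T (indicatorConstLp 2 (hfm i) hi (1 : ℂ)) = 0) :
    T (indicatorConstLp 2 (MeasurableSet.iUnion hfm) hfin (1 : ℂ)) = 0 := by
  have hpm := measurableSet_punion hfm
  have hpf : ∀ n, μ (punion f n) ≠ ∞ := fun n =>
    ((measure_mono (punion_subset f n)).trans_lt hfin.lt_top).ne
  have hff : ∀ i, μ (f i) ≠ ∞ := fun i => ((measure_mono (subset_iUnion f i)).trans_lt hfin.lt_top).ne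
  have hstep : ∀ n, T (indicatorConstLp 2 (hpm n) (hpf n) (1 : ℂ)) = 0 := by
    intro n
    induction n with
    | zero => exact h0 0 (hff 0)
    | succ n ih =>
      have h' : indicatorConstLp 2 (hpm (n + 1)) (hpf (n + 1)) (1 : ℂ) =
          indicatorConstLp 2 (hpm n) (hpf n) 1 + indicatorConstLp 2 (hfm (n + 1)) (hff (n + 1)) 1 :=
        indicatorConstLp_disjoint_union (hpm n) (hfm (n + 1)) (hpf n) (hff (n + 1))
          (disjoint_punion hdisj n (n + 1) (Nat.lt_succ_self n)) (1 : ℂ)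
      rw [h', map_add, ih, h0 (n + 1) (hff (n + 1)), add_zero]
  have htend : Tendsto (fun n => indicatorConstLp 2 (hpm n) (hpf n) (1 : ℂ)) atTop
      (𝓝 (indicatorConstLp 2 (MeasurableSet.iUnion hfm) hfin (1 : ℂ))) := by
    refine tendsto_indicatorConstLp_set (by norm_num) ?_
    have hanti : Antitone fun n => (⋃ i, f i) \ punion f n :=
      fun n m hnm => Set.sdiff_subset_sdiff_right (monotone_punion f hnm)
    have hlim := tendsto_measure_iInter_atTop (μ := μ)
      (fun n => ((MeasurableSet.iUnion hfm).diff (hpm n)).nullMeasurableSet) hanti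
      ⟨0, ((measure_mono Set.sdiff_subset).trans_lt hfin.lt_top).ne⟩
    have hempty : ⋂ n, (⋃ i, f i) \ punion f n = ∅ := by
      rw [← Set.sdiff_iUnion, iUnion_punion, Set.sdiff_self]
    rw [hempty, measure_empty] at hlim
    refine hlim.congr fun n => ?_
    simp only [Function.comp_apply]
    rw [symmDiff_of_le (punion_subset f n)]
  have hT : Tendsto (fun _ : ℕ => (0 : Lp ℂ 2 μ)) atTop
      (𝓝 (T (indicatorConstLp 2 (MeasurableSet.iUnion hfm) hfin (1 : ℂ)))) :=
    ((T.continuous.tendsto _).comp htend).congr fun n => by simp only [Function.comp_apply, hstep]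
  exact tendsto_nhds_unique hT tendsto_const_nhds

/-! ## §4 Dynkin's π-λ argument and density -/

/-- **(D) density.**  A bounded operator on `L²(X)` killing the indicator of every coset of every member
of a decreasing neighbourhood basis `B` of compact open subgroups is zero.
[cite: MoeglinVignerasWaldspurger1987, Chap. 2 I.3] -/
theorem eq_zero_of_vanish_on_cosets [SecondCountableTopology X] (B : ℕ → AddSubgroup X)
    (hBo : ∀ k, IsOpen (B k : Set X)) (hBc : ∀ k, IsCompact (B k : Set X)) (hBanti : Antitone B)
    (hBnhds : ∀ U ∈ 𝓝 (0 : X), ∃ k, (B k : Set X) ⊆ U)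
    (T : Lp ℂ 2 μ →L[ℂ] Lp ℂ 2 μ)
    (hT : ∀ k a (h : μ (coset (B k) a) ≠ ∞),
      T (indicatorConstLp 2 (measurableSet_coset (hBo k).measurableSet a) h (1 : ℂ)) = 0) :
    T = 0 := by
  classical
  have hSm : ∀ k a, MeasurableSet (coset (B k) a) := fun k a => measurableSet_coset (hBo k).measurableSet a
  have hSf : ∀ k a, μ (coset (B k) a) ≠ ∞ := fun k a => by
    rw [measure_coset μ (hBo k).measurableSet a]; exact (hBc k).measure_lt_top.ne
  -- the family of all cosets is a basis of the topology and a π-system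
  set 𝒮 : Set (Set X) := {S | ∃ k a, S = coset (B k) a} with h𝒮
  have hbasis : TopologicalSpace.IsTopologicalBasis 𝒮 := by
    apply TopologicalSpace.isTopologicalBasis_of_isOpen_of_nhds
    · rintro _ ⟨k, a, rfl⟩
      exact isOpen_coset (hBo k) a
    · intro a U haU hU
      have hmem : (fun t : X => a + t) ⁻¹' U ∈ 𝓝 (0 : X) :=
        (hU.preimage (continuous_const.add continuous_id)).mem_nhds (by simpa using haU)
      obtain ⟨k, hk⟩ := hBnhds _ hmem
      refine ⟨coset (B k) a, ⟨k, a, rfl⟩, self_mem_coset _ _, fun u hu => ?_⟩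
      rw [mem_coset] at hu
      simpa using hk hu
  have hgen : ‹MeasurableSpace X› = MeasurableSpace.generateFrom 𝒮 := by
    rw [‹BorelSpace X›.measurable_eq]; exact hbasis.borel_eq_generateFrom
  have hpi : IsPiSystem 𝒮 := by
    rintro _ ⟨k, a, rfl⟩ _ ⟨j, a', rfl⟩ ⟨x, hx, hx'⟩
    rcases le_total k j with hkj | hjk
    · exact ⟨j, a', Set.inter_eq_right.2 (coset_subset_of_le (hBanti hkj) hx hx')⟩
    · exact ⟨k, a, Set.inter_eq_left.2 (coset_subset_of_le (hBanti hjk) hx' hx)⟩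
  -- Dynkin: `T 1_{t ∩ S₀} = 0` for every measurable `t` and every coset `S₀` of `B 0`
  have hD : ∀ t (ht : MeasurableSet t), ∀ a₀ : X,
      T (indicatorConstLp 2 (ht.inter (hSm 0 a₀))
        (((measure_mono Set.inter_subset_right).trans_lt (hSf 0 a₀).lt_top).ne) (1 : ℂ)) = 0 := by
    intro t ht
    induction t, ht using MeasurableSpace.induction_on_inter hgen hpi with
    | empty =>
      intro a₀
      rw [indicatorConstLp_set_congr μ _ _ MeasurableSet.empty (by simp) (Set.empty_inter _) 1,
        indicatorConstLp_empty, map_zero]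
    | basic t ht' =>
      obtain ⟨k, a, rfl⟩ := ht'
      intro a₀
      by_cases hne : (coset (B k) a ∩ coset (B 0) a₀).Nonempty
      · obtain ⟨x, hx, hx₀⟩ := hne
        have hsub : coset (B k) a ⊆ coset (B 0) a₀ := coset_subset_of_le (hBanti (Nat.zero_le k)) hx₀ hx
        rw [indicatorConstLp_set_congr μ _ _ (hSm k a) (hSf k a) (Set.inter_eq_left.2 hsub) 1]
        exact hT k a (hSf k a)
      · rw [indicatorConstLp_set_congr μ _ _ MeasurableSet.empty (by simp) (Set.not_nonempty_iff_eq_empty.1 hne) 1,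
          indicatorConstLp_empty, map_zero]
    | compl t ht iht =>
      intro a₀
      have hdisj : Disjoint (t ∩ coset (B 0) a₀) (tᶜ ∩ coset (B 0) a₀) :=
        disjoint_compl_right.mono inter_subset_left inter_subset_left
      have hunion : t ∩ coset (B 0) a₀ ∪ tᶜ ∩ coset (B 0) a₀ = coset (B 0) a₀ := by
        rw [← Set.union_inter_distrib_right, Set.union_compl_self, Set.univ_inter]
      have hf1 : μ (t ∩ coset (B 0) a₀) ≠ ∞ :=
        ((measure_mono Set.inter_subset_right).trans_lt (hSf 0 a₀).lt_top).ne
      have hf2 : μ (tᶜ ∩ coset (B 0) a₀) ≠ ∞ :=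
        ((measure_mono Set.inter_subset_right).trans_lt (hSf 0 a₀).lt_top).ne
      have hsum := indicatorConstLp_disjoint_union (p := 2) (μ := μ) (ht.inter (hSm 0 a₀))
        (ht.compl.inter (hSm 0 a₀)) hf1 hf2 hdisj (1 : ℂ)
      have hS : T (indicatorConstLp 2 ((ht.inter (hSm 0 a₀)).union (ht.compl.inter (hSm 0 a₀)))
          (((measure_mono (hunion.le)).trans_lt (hSf 0 a₀).lt_top).ne) (1 : ℂ)) = 0 := by
        rw [indicatorConstLp_set_congr μ _ _ (hSm 0 a₀) (hSf 0 a₀) hunion 1]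
        exact hT 0 a₀ (hSf 0 a₀)
      rw [hsum, map_add, iht a₀, zero_add] at hS
      exact hS
    | iUnion f hdisj hfm ihf =>
      intro a₀
      have hfin' : μ (⋃ i, f i ∩ coset (B 0) a₀) ≠ ∞ :=
        ((measure_mono (iUnion_subset fun i => inter_subset_right)).trans_lt (hSf 0 a₀).lt_top).ne
      have key := map_indicatorConstLp_iUnion_eq_zero μ T (fun i => f i ∩ coset (B 0) a₀)
        (fun i => (hfm i).inter (hSm 0 a₀))
        (fun i j hij => (hdisj hij).mono inter_subset_left inter_subset_left) hfin'
        (fun i _ => ihf i a₀)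
      rw [indicatorConstLp_set_congr μ _ _ (MeasurableSet.iUnion fun i => (hfm i).inter (hSm 0 a₀)) hfin'
        (Set.iUnion_inter _ f) 1]
      exact key
  -- all measurable sets of finite measure, via a countable cover by cosets of `B 0`
  have hfinite : ∀ t (ht : MeasurableSet t) (hμt : μ t ≠ ∞), T (indicatorConstLp 2 ht hμt (1 : ℂ)) = 0 := by
    intro t ht hμt
    obtain ⟨d, hd⟩ := TopologicalSpace.exists_dense_seq X
    set C : ℕ → Set X := fun m => coset (B 0) (d m) with hCdef
    have hCm : ∀ m, MeasurableSet (C m) := fun m => hSm 0 (d m)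
    have hcover : ∀ x : X, ∃ m, x ∈ C m := by
      intro x
      have hopen : IsOpen {y : X | x - y ∈ B 0} := (hBo 0).preimage (continuous_const.sub continuous_id)
      obtain ⟨m, hm⟩ := hd.exists_mem_open hopen ⟨x, by simp [(B 0).zero_mem]⟩
      exact ⟨m, mem_coset.2 hm⟩
    set g : ℕ → Set X := fun m => t ∩ disjointed C m with hgdef
    have hgm : ∀ m, MeasurableSet (g m) := fun m => ht.inter (MeasurableSet.disjointed hCm m)
    have hgdisj : Pairwise (Disjoint on g) := fun i j hij =>
      (disjoint_disjointed C hij).mono inter_subset_right inter_subset_right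
    have hgU : (⋃ m, g m) = t := by
      rw [hgdef, ← Set.inter_iUnion, iUnion_disjointed, Set.inter_eq_left]
      exact fun x _ => mem_iUnion.2 (hcover x)
    have hg0 : ∀ m (hm : μ (g m) ≠ ∞), T (indicatorConstLp 2 (hgm m) hm 1) = 0 := by
      intro m hm
      have hset : g m = (t ∩ disjointed C m) ∩ coset (B 0) (d m) :=
        (Set.inter_eq_left.2 (inter_subset_right.trans (disjointed_subset C m))).symm
      rw [indicatorConstLp_set_congr μ _ _ ((ht.inter (MeasurableSet.disjointed hCm m)).inter (hSm 0 (d m)))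
        (((measure_mono Set.inter_subset_right).trans_lt (hSf 0 (d m)).lt_top).ne) hset 1]
      exact hD _ (ht.inter (MeasurableSet.disjointed hCm m)) (d m)
    have key := map_indicatorConstLp_iUnion_eq_zero μ T g hgm hgdisj (by rw [hgU]; exact hμt) hg0
    rw [indicatorConstLp_set_congr μ _ _ ht hμt hgU 1] at key
    exact key
  -- density of simple functions
  have hLp : ∀ f : Lp ℂ 2 μ, T f = 0 := by
    refine Lp.induction (μ := μ) ENNReal.ofNat_ne_top (motive := fun f => T f = 0) ?_ ?_ ?_
    · intro c s hs hμs
      rw [Lp.simpleFunc.coe_indicatorConst, indicatorConstLp_eq_smul_one μ hs hμs.ne c, map_smul,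
        hfinite s hs hμs.ne, smul_zero]
    · intro f g hf hg _ hf0 hg0
      rw [map_add, hf0, hg0, add_zero]
    · exact isClosed_singleton.preimage T.continuous
  exact ContinuousLinearMap.ext hLp

end Density

end Literature.RepresentationTheory.HeisenbergGroup.SchrodingerIrreducible
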